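import Summits.ResolutionOfSingularities.ResolutionOfSingularities.Theorems.FrobeniusLadderFInjectiveMacaulayficationIsBlowupStalkTransfer
import Summits.ResolutionOfSingularities.ResolutionOfSingularities.Theorems.FrobeniusLadderFInjectiveMacaulayficationDegreeZeroDescentLocal
import Literature.AlgebraicGeometry.Resolution.BlowupAlgebraPrimesPoints
import Literature.AlgebraicGeometry.Resolution.KollarBlowupSequenceFunctors
import Mathlib.AlgebraicGeometry.Noetherian
import HarnessLib

/-!
# FC′ FROM ONE FULL MODEL — the common consumer interface of the FC′ rungs
# (crux `FInjectiveMacaulayfication` stmt-ResolutionOfSingularities-15315, chain w45a, hole #3γ; res-L1-w45a-plan-1 R13.21 (2)(a);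
# seat res-L1-w45a-stub-3)

[OURS · L1 W4.5a] Support file (`--supports stmt-ResolutionOfSingularities-15315 --as helper`); NOT a statement of any manuscript; no named
fact; AI-written (AI review is weaker than expert review).

The conclusion of the v29 door stub `GenericFibreReduction.FCForallExists` (`…FCForallExists.lean`) at a point `η` of `X₁` asks for an ideal
sheaf `J ≠ ⊥` with `η ∈ supp J`, a LocFix datum `c'` at `η` (`(c') ≠ 0`, `(c') ≤ 𝔪_η`, every chart of `Bl_{(c')} Spec 𝒪_{X₁,η}` FULL over `𝔪_η`)
with `J_η = (c')`, and the fibre condition: every blowing up along `J` is FULL at the non-closed points over `supp J ∖ {η}` and Cohen–Macaulay at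
the closed points over `supp J`. ALL the rungs built so far produce this from ONE MODEL: a blowing up `ρ : T → X₁` along some `J ∋ η` which is
FULL at every point over `supp J` — strat-1's `FCRungsSig` §A1 (`T` regular), the cylinders `…FCForallExistsCylinder(Fin)` (`T = Bl_I × 𝔸ᴺ`),
the dim ≤ 2 assembly of `Dim2FCSig`, and any witness rule of idea-2. This file isolates that step once:

* `fcForallExists_body_of_fullModel` — **`X₁` locally Noetherian, `J ≠ ⊥`, `η ∈ supp J`, `J_η ≠ ⊥`, `ρ : T → X₁` a blowing up along `J`
  (universal property `IsBlowup`) with `𝒪_{T,t}` FULL (domain ∧ clause) for every `t` over `supp J` ⟹ the seven conjuncts at `η`** with the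
  witness `J` itself and `c' :=` any finite generating family of `J_η`: the charts of `Bl_{(c')} Spec 𝒪_η` over `𝔪_η` are local rings of `T` over
  `η` (reverse dictionary `IsBlowup.exists_point_of_blowupAlgebra_prime`, Stacks 0804/0805), and every blowing up along `J` has the stalks of
  `T` (`IsBlowup.unique`, `IsBlowupStalkTransfer`);
* `fcForallExists_body_of_fullModel_of_isIntegral` — the same with `J_η ≠ ⊥` discharged on an integral `X₁` (`stalkIdeal_ne_bot_of_ne_bot`);
* `full_of_isBlowup_of_fullModel` — the (nc)/(cl)-free form: every stalk over `supp J` of every blowing up along `J` is FULL.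

Consumers instantiate by `exact` (the conclusion is the FC′ text verbatim). No definitions, no named facts.
[folklore assembly; cite: StacksProject, Tag 0804, Tag 0805; GortzWedhorn2020, Def. 13.90]
-/

-- single-problem summit: the doubled namespace component is forced
set_option linter.dupNamespace false

noncomputable section

open AlgebraicGeometry CategoryTheory Literature.AlgebraicGeometry.Resolution TopologicalSpace IsLocalRing

namespace Summit.ResolutionOfSingularities.ResolutionOfSingularities.Theorems.FInjectiveMacaulayfication.FCForallExistsOfFullModel

open Summit.ResolutionOfSingularities.ResolutionOfSingularities.Theorems.FInjectiveMacaulayfication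

/-- **Every blowing up along `J` is FULL over `supp J` as soon as ONE is.** If `ρ : T → X₁` is a blowing up along `J` whose stalks over
`supp J` are domains satisfying the clause, then so are the stalks over `supp J` of every blowing up `π : X₂ → X₁` along `J` — two blowing
ups along the same ideal sheaf have the same stalks over the same points (`IsBlowup.unique`). [cite: GortzWedhorn2020, Def. 13.90] -/
theorem full_of_isBlowup_of_fullModel (p : ℕ) [Fact p.Prime] (X₁ : Scheme.{0}) (J : X₁.IdealSheafData)
    (T : Scheme.{0}) (ρ : T ⟶ X₁) (hρ : IsBlowup ρ J)
    (hfull : ∀ t : T, ρ.base t ∈ (J.support : Set X₁) →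
      IsDomain (T.presheaf.stalk t) ∧ ∀ d : ℕ, ringKrullDim (T.presheaf.stalk t) = d → ∀ s : Fin d → T.presheaf.stalk t,
        (Ideal.span (Set.range s)).radical.IsMaximal → RingTheory.Sequence.IsWeaklyRegular (T.presheaf.stalk t) (List.ofFn s) ∧
        ∀ u : T.presheaf.stalk t, (∃ e : ℕ, u ^ p ^ e ∈ Ideal.span ((fun z : T.presheaf.stalk t => z ^ p ^ e) ''
          (Ideal.span (Set.range s) : Set (T.presheaf.stalk t)))) → u ∈ Ideal.span (Set.range s)) :
    ∀ (X₂ : Scheme.{0}) (π : X₂ ⟶ X₁), IsBlowup π J → ∀ x : X₂, π.base x ∈ (J.support : Set X₁) →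
      IsDomain (X₂.presheaf.stalk x) ∧ ∀ d : ℕ, ringKrullDim (X₂.presheaf.stalk x) = d → ∀ s : Fin d → X₂.presheaf.stalk x,
        (Ideal.span (Set.range s)).radical.IsMaximal → RingTheory.Sequence.IsWeaklyRegular (X₂.presheaf.stalk x) (List.ofFn s) ∧
        ∀ u : X₂.presheaf.stalk x, (∃ e : ℕ, u ^ p ^ e ∈ Ideal.span ((fun z : X₂.presheaf.stalk x => z ^ p ^ e) ''
          (Ideal.span (Set.range s) : Set (X₂.presheaf.stalk x)))) → u ∈ Ideal.span (Set.range s) := by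
  intro X₂ π hπ x hx
  obtain ⟨t, ht, ⟨e⟩⟩ := IsBlowupStalkTransfer.stub_isBlowupStalkTransfer X₁ X₂ T J π ρ hπ hρ x
  obtain ⟨hdom, hcl⟩ := hfull t (by rw [ht]; exact hx)
  haveI := hdom
  exact ⟨MulEquiv.isDomain _ e.toMulEquiv,
    DegreeZeroDescent.inlineClause_of_ringEquiv p (L := T.presheaf.stalk t) (L' := X₂.presheaf.stalk x) e.symm hcl⟩

/-- **FC′ FROM ONE FULL MODEL.** `X₁` locally Noetherian, `J ≠ ⊥` an ideal sheaf with `η ∈ supp J` and `J_η ≠ ⊥`, and `ρ : T → X₁` ONE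
blowing up along `J` (universal property) whose stalks over `supp J` are FULL (domain ∧ every system of parameters weakly regular ∧ parameter
ideals Frobenius closed). THEN the seven conjuncts of the conclusion of `GenericFibreReduction.FCForallExists` hold at `η`, with the witness
`J` and `c' :=` a finite generating family of `J_η`: `(c') ≠ ⊥`, `(c') ≤ 𝔪_η` (`η ∈ supp J`), every chart of `Bl_{(c')} Spec 𝒪_η` over `𝔪_η` is
the local ring of a point of `T` over `η` (Stacks 0804/0805, `IsBlowup.exists_point_of_blowupAlgebra_prime`) hence FULL, `J_η = (c')`, and every
blowing up along `J` is FULL over `supp J` (`full_of_isBlowup_of_fullModel`) — in particular (nc) and (cl). The input point-fix of FC′ is not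
used (currency (A′)). [folklore assembly; cite: StacksProject, Tag 0804, Tag 0805] -/
theorem fcForallExists_body_of_fullModel (p : ℕ) [Fact p.Prime] (X₁ : Scheme.{0}) [IsLocallyNoetherian X₁] (η : X₁)
    (J : X₁.IdealSheafData) (hJ0 : J ≠ ⊥) (hηJ : η ∈ (J.support : Set X₁)) (hJη : stalkIdeal J η ≠ ⊥)
    (T : Scheme.{0}) (ρ : T ⟶ X₁) (hρ : IsBlowup ρ J)
    (hfull : ∀ t : T, ρ.base t ∈ (J.support : Set X₁) →
      IsDomain (T.presheaf.stalk t) ∧ ∀ d : ℕ, ringKrullDim (T.presheaf.stalk t) = d → ∀ s : Fin d → T.presheaf.stalk t,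
        (Ideal.span (Set.range s)).radical.IsMaximal → RingTheory.Sequence.IsWeaklyRegular (T.presheaf.stalk t) (List.ofFn s) ∧
        ∀ u : T.presheaf.stalk t, (∃ e : ℕ, u ^ p ^ e ∈ Ideal.span ((fun z : T.presheaf.stalk t => z ^ p ^ e) ''
          (Ideal.span (Set.range s) : Set (T.presheaf.stalk t)))) → u ∈ Ideal.span (Set.range s)) :
    ∃ (J' : X₁.IdealSheafData) (n' : ℕ) (c' : Fin n' → X₁.presheaf.stalk η), J' ≠ ⊥ ∧ η ∈ (J'.support : Set X₁) ∧
      Ideal.span (Set.range c') ≠ ⊥ ∧ Ideal.span (Set.range c') ≤ maximalIdeal (X₁.presheaf.stalk η) ∧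
      (∀ (j : Fin n') (𝔔 : PrimeSpectrum (blowupAlgebra (Ideal.span (Set.range c')) (c' j))),
        𝔔.asIdeal.comap (algebraMap (X₁.presheaf.stalk η) (blowupAlgebra (Ideal.span (Set.range c')) (c' j))) =
          maximalIdeal (X₁.presheaf.stalk η) →
        IsDomain (Localization.AtPrime 𝔔.asIdeal) ∧ ∀ d : ℕ, ringKrullDim (Localization.AtPrime 𝔔.asIdeal) = d →
          ∀ s : Fin d → Localization.AtPrime 𝔔.asIdeal, (Ideal.span (Set.range s)).radical.IsMaximal →
            RingTheory.Sequence.IsWeaklyRegular (Localization.AtPrime 𝔔.asIdeal) (List.ofFn s) ∧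
            ∀ y : Localization.AtPrime 𝔔.asIdeal, (∃ e : ℕ, y ^ p ^ e ∈ Ideal.span ((fun z : Localization.AtPrime 𝔔.asIdeal => z ^ p ^ e) ''
              (Ideal.span (Set.range s) : Set (Localization.AtPrime 𝔔.asIdeal)))) → y ∈ Ideal.span (Set.range s)) ∧
      stalkIdeal J' η = Ideal.span (Set.range c') ∧
      (∀ (X₂ : Scheme.{0}) (π : X₂ ⟶ X₁), IsBlowup π J' →
        (∀ x : X₂, π.base x ∈ (J'.support : Set X₁) → π.base x ≠ η → ¬ IsClosed ({x} : Set X₂) →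
          IsDomain (X₂.presheaf.stalk x) ∧ ∀ d : ℕ, ringKrullDim (X₂.presheaf.stalk x) = d → ∀ s : Fin d → X₂.presheaf.stalk x,
            (Ideal.span (Set.range s)).radical.IsMaximal → RingTheory.Sequence.IsWeaklyRegular (X₂.presheaf.stalk x) (List.ofFn s) ∧
            ∀ t : X₂.presheaf.stalk x, (∃ e : ℕ, t ^ p ^ e ∈ Ideal.span ((fun z : X₂.presheaf.stalk x => z ^ p ^ e) ''
              (Ideal.span (Set.range s) : Set (X₂.presheaf.stalk x)))) → t ∈ Ideal.span (Set.range s)) ∧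
        (∀ x : X₂, π.base x ∈ (J'.support : Set X₁) → IsClosed ({x} : Set X₂) →
          ∀ d : ℕ, ringKrullDim (X₂.presheaf.stalk x) = d → ∀ s : Fin d → X₂.presheaf.stalk x,
            (Ideal.span (Set.range s)).radical.IsMaximal → RingTheory.Sequence.IsWeaklyRegular (X₂.presheaf.stalk x) (List.ofFn s))) := by
  classical
  -- `c'` := a finite generating family of the stalk ideal `J_η` (the stalk is Noetherian)
  obtain ⟨n', c', hc'⟩ : ∃ (n' : ℕ) (c' : Fin n' → X₁.presheaf.stalk η), Ideal.span (Set.range c') = stalkIdeal J η :=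
    Submodule.fg_iff_exists_fin_generating_family.mp (IsNoetherian.noetherian _)
  have hall := full_of_isBlowup_of_fullModel p X₁ J T ρ hρ hfull
  refine ⟨J, n', c', hJ0, hηJ, ?_, ?_, ?_, hc'.symm, fun X₂ π hπ => ⟨fun x hx _ _ => hall X₂ π hπ x hx,
    fun x hx _ d hd s hs => ((hall X₂ π hπ x hx).2 d hd s hs).1⟩⟩
  · rw [hc']; exact hJη
  · rw [hc']; exact (mem_support_iff_stalkIdeal_le J η).mp hηJ
  · -- the charts of `Bl_{(c')} Spec 𝒪_η` over `𝔪_η` are stalks of `T` over `η`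
    intro j 𝔔 h𝔔
    obtain ⟨t, ht, ⟨e⟩⟩ := hρ.exists_point_of_blowupAlgebra_prime η c' hc' j 𝔔 h𝔔
    obtain ⟨hdom, hcl⟩ := hfull t (by rw [show ρ.base t = η from ht]; exact hηJ)
    haveI := hdom
    exact ⟨MulEquiv.isDomain _ e.symm.toMulEquiv,
      DegreeZeroDescent.inlineClause_of_ringEquiv p (L := T.presheaf.stalk t) (L' := Localization.AtPrime 𝔔.asIdeal) e hcl⟩

/-- **FC′ FROM ONE FULL MODEL, integral base.** On an integral locally Noetherian `X₁` the hypothesis `J_η ≠ ⊥` of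
`fcForallExists_body_of_fullModel` follows from `J ≠ ⊥` (`stalkIdeal_ne_bot_of_ne_bot`). [folklore] -/
theorem fcForallExists_body_of_fullModel_of_isIntegral (p : ℕ) [Fact p.Prime] (X₁ : Scheme.{0}) [IsLocallyNoetherian X₁] [IsIntegral X₁]
    (η : X₁) (J : X₁.IdealSheafData) (hJ0 : J ≠ ⊥) (hηJ : η ∈ (J.support : Set X₁))
    (T : Scheme.{0}) (ρ : T ⟶ X₁) (hρ : IsBlowup ρ J)
    (hfull : ∀ t : T, ρ.base t ∈ (J.support : Set X₁) →
      IsDomain (T.presheaf.stalk t) ∧ ∀ d : ℕ, ringKrullDim (T.presheaf.stalk t) = d → ∀ s : Fin d → T.presheaf.stalk t,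
        (Ideal.span (Set.range s)).radical.IsMaximal → RingTheory.Sequence.IsWeaklyRegular (T.presheaf.stalk t) (List.ofFn s) ∧
        ∀ u : T.presheaf.stalk t, (∃ e : ℕ, u ^ p ^ e ∈ Ideal.span ((fun z : T.presheaf.stalk t => z ^ p ^ e) ''
          (Ideal.span (Set.range s) : Set (T.presheaf.stalk t)))) → u ∈ Ideal.span (Set.range s)) :
    ∃ (J' : X₁.IdealSheafData) (n' : ℕ) (c' : Fin n' → X₁.presheaf.stalk η), J' ≠ ⊥ ∧ η ∈ (J'.support : Set X₁) ∧
      Ideal.span (Set.range c') ≠ ⊥ ∧ Ideal.span (Set.range c') ≤ maximalIdeal (X₁.presheaf.stalk η) ∧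
      (∀ (j : Fin n') (𝔔 : PrimeSpectrum (blowupAlgebra (Ideal.span (Set.range c')) (c' j))),
        𝔔.asIdeal.comap (algebraMap (X₁.presheaf.stalk η) (blowupAlgebra (Ideal.span (Set.range c')) (c' j))) =
          maximalIdeal (X₁.presheaf.stalk η) →
        IsDomain (Localization.AtPrime 𝔔.asIdeal) ∧ ∀ d : ℕ, ringKrullDim (Localization.AtPrime 𝔔.asIdeal) = d →
          ∀ s : Fin d → Localization.AtPrime 𝔔.asIdeal, (Ideal.span (Set.range s)).radical.IsMaximal →
            RingTheory.Sequence.IsWeaklyRegular (Localization.AtPrime 𝔔.asIdeal) (List.ofFn s) ∧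
            ∀ y : Localization.AtPrime 𝔔.asIdeal, (∃ e : ℕ, y ^ p ^ e ∈ Ideal.span ((fun z : Localization.AtPrime 𝔔.asIdeal => z ^ p ^ e) ''
              (Ideal.span (Set.range s) : Set (Localization.AtPrime 𝔔.asIdeal)))) → y ∈ Ideal.span (Set.range s)) ∧
      stalkIdeal J' η = Ideal.span (Set.range c') ∧
      (∀ (X₂ : Scheme.{0}) (π : X₂ ⟶ X₁), IsBlowup π J' →
        (∀ x : X₂, π.base x ∈ (J'.support : Set X₁) → π.base x ≠ η → ¬ IsClosed ({x} : Set X₂) →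
          IsDomain (X₂.presheaf.stalk x) ∧ ∀ d : ℕ, ringKrullDim (X₂.presheaf.stalk x) = d → ∀ s : Fin d → X₂.presheaf.stalk x,
            (Ideal.span (Set.range s)).radical.IsMaximal → RingTheory.Sequence.IsWeaklyRegular (X₂.presheaf.stalk x) (List.ofFn s) ∧
            ∀ t : X₂.presheaf.stalk x, (∃ e : ℕ, t ^ p ^ e ∈ Ideal.span ((fun z : X₂.presheaf.stalk x => z ^ p ^ e) ''
              (Ideal.span (Set.range s) : Set (X₂.presheaf.stalk x)))) → t ∈ Ideal.span (Set.range s)) ∧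
        (∀ x : X₂, π.base x ∈ (J'.support : Set X₁) → IsClosed ({x} : Set X₂) →
          ∀ d : ℕ, ringKrullDim (X₂.presheaf.stalk x) = d → ∀ s : Fin d → X₂.presheaf.stalk x,
            (Ideal.span (Set.range s)).radical.IsMaximal → RingTheory.Sequence.IsWeaklyRegular (X₂.presheaf.stalk x) (List.ofFn s))) :=
  fcForallExists_body_of_fullModel p X₁ η J hJ0 hηJ (stalkIdeal_ne_bot_of_ne_bot hJ0 η) T ρ hρ hfull

end Summit.ResolutionOfSingularities.ResolutionOfSingularities.Theorems.FInjectiveMacaulayfication.FCForallExistsOfFullModel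

end
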